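import Summits.BirchSwinnertonDyer.BirchSwinnertonDyer.Theorems.CyclotomicUntwistNineIntegersStructure
import Summits.BirchSwinnertonDyer.BirchSwinnertonDyer.Theorems.CyclotomicUntwistDescendedFrobeniusTransferBasis
import Literature.NumberTheory.EllipticCurves.PadicSeriesEvaluation
import HarnessLib

/-!
# Integral coordinates in the power basis `1, ζ₉, …, ζ₉⁵` of `L = ℚ₃(ζ₉)` over `ℚ₃`, and the coefficientwise
# decomposition of `L`-series along it: bounded denominators over `L` ⟺ bounded denominators of the `ℚ₃`-coordinates
# (base change `V_{E₀ ⊗ 𝓞} = V_{E₀} ⊗_{ℚ₃} L`, work package W4-a of the elementary route to Katz's rank statement)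

Cell `pub/bsd-wall` (D-0145 line `route-BirchSwinnertonDyer-CyclotomicUntwist`), width seat `bsd-line-cycu-p4` (gen 8); work
package W4 of cycu-p3 g8's memo `Cruxes/PSRankOneLowerHalfAtThree/KATZ-FROBENIUS-MOD-VARPI-v2.md` (base-change sub-lemma
released by cycu-p2 g6, 13:19Z), toward the Literature fact `katz_dieudonne_rank_le_two` (p636408) as a THEOREM. THEOREMS
ONLY (no definition, no named fact, no `sorry`); helper `--supports` K1 = stmt-BirchSwinnertonDyer-21580. BSD is not proved by
this file and no crux / stub is.

With `b` = the power basis of `L = ℚ₃(ζ₉)` over `ℚ₃` attached to `ζ₉` (`IsPrimitiveRoot.powerBasis`, `b i = ζ₉^i`,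
`i < 6`):

* §1 **`norm_repr_le_one_of_mem`** — an element of `𝓞 = integralClosure ℤ₃ L` has `ℤ₃`-INTEGRAL coordinates
  (`𝓞 = ℤ₃[ζ₉]`, `NineIntegers.integralClosure_eq_adjoin`, reduced modulo the monic `Φ₉ ∈ ℤ₃[X]`); hence
  `norm_pow_mul_repr_le_one` (`3ᵈx ∈ 𝓞 ⇒ ‖3ᵈ·xᵢ‖ ≤ 1`) and the converse `isIntegral_pow_mul_of_coords`;
* §2 coordinate series of `F ∈ L⟦σ⟧` along `b` (no definition: a family `G : Fin 6 → ℚ₃⟦σ⟧` with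
  `b.repr ([e]F) i = [e](G i)`): `exists_coords`, `eq_sum_of_coords` (`F = Σ C(bᵢ)·Gᵢ`), `coords_of_eq_sum` (uniqueness),
  **`hbd_coords_iff`** (`3ᵈF ∈ 𝓞⟦σ⟧ ⟺ ∀ i, 3ᵈGᵢ ∈ ℤ₃⟦σ⟧`), `coords_subst` (substituting a `ℚ₃`-series commutes with
  taking coordinates), `coords_expand`, `coords_natCast_mul` (log-type bounds pass to coordinates), `coords_constantCoeff`.

References: N. M. Katz, LNM 868 (1981) Thm 5.3.3 ("formation commutes with extension of scalars") [Katz1981CrystallineDieudonne];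
L. Washington, *Cyclotomic Fields*, Prop. 1.2/Lemma 1.4 (`𝓞_{ℚ_p(ζ)} = ℤ_p[ζ]`) [Washington1997].
-/

set_option autoImplicit false
-- single-conjunct summit: `Summit.BirchSwinnertonDyer.BirchSwinnertonDyer.…` repeats the name by design
set_option linter.dupNamespace false

noncomputable section

open scoped Classical
open PowerSeries Polynomial IsCyclotomicExtension Literature.NumberTheory.EllipticCurves
  Literature.NumberTheory.EllipticCurves.DescendedFrobenius
  Summit.BirchSwinnertonDyer.BirchSwinnertonDyer.Theorems.NineIntegers
  Summit.BirchSwinnertonDyer.BirchSwinnertonDyer.Theorems.DescendedFrobeniusTransfer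

namespace Summit.BirchSwinnertonDyer.BirchSwinnertonDyer.Theorems.NineCoordinates

/-! ### §1 Integral elements have integral coordinates in the power basis of `ζ₉` -/

/-- The power basis of `ζ₉` has `6 = φ(9)` elements. [cite: Washington1997, Prop. 1.2] -/
theorem powerBasis_dim : (zeta_spec.powerBasis ℚ_[3]).dim = 6 := by
  rw [IsPrimitiveRoot.powerBasis_dim, minpoly_zeta_eq_cyclotomic, natDegree_cyclotomic]
  rfl

/-- **Integral elements of `ℚ₃(ζ₉)` have `ℤ₃`-integral coordinates in the power basis `(ζ₉ⁱ)_{i<6}`** (`𝓞 = ℤ₃[ζ₉]`: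
write `x = q(ζ₉)`, `q ∈ ℤ₃[X]`, and reduce `q` modulo the monic `Φ₉ ∈ ℤ₃[X]`). [cite: Washington1997, Prop. 1.2] -/
theorem norm_repr_le_one_of_mem {x : KNine} (hx : x ∈ ONine) (i : Fin (zeta_spec.powerBasis ℚ_[3]).dim) :
    ‖(zeta_spec.powerBasis ℚ_[3]).basis.repr x i‖ ≤ 1 := by
  set ζ := zeta 9 ℚ_[3] KNine with hζ
  obtain ⟨q, rfl⟩ := exists_aeval_eq_of_mem hx
  set P : ℤ_[3][X] := cyclotomic 9 ℤ_[3] with hP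
  have hPm : P.Monic := cyclotomic.monic 9 ℤ_[3]
  have hP1 : P ≠ 1 := by
    intro h
    have := congrArg natDegree h
    rw [hP, natDegree_cyclotomic, natDegree_one] at this
    exact absurd this (by decide)
  have hPζ : aeval ζ P = 0 := by
    rw [hP, ← aeval_map_algebraMap ℚ_[3], map_cyclotomic, aeval_def, ← eval_map, map_cyclotomic, ← IsRoot.def,
      isRoot_cyclotomic_iff]
    exact zeta_spec
  set r := q %ₘ P with hr
  have hPdeg : P.natDegree = 6 := by rw [hP, natDegree_cyclotomic]; rfl
  have hdeg : r.natDegree < (zeta_spec.powerBasis ℚ_[3]).dim := by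
    rw [powerBasis_dim, ← hPdeg]
    exact natDegree_modByMonic_lt q hPm hP1
  have hx' : aeval ζ q = aeval ζ r := by
    conv_lhs => rw [← modByMonic_add_div q P]
    rw [map_add, map_mul, hPζ, zero_mul, add_zero]
  -- `x = Σ (r.coeff i) ζ^i` on the power basis
  have hsum : aeval ζ r = ∑ i : Fin (zeta_spec.powerBasis ℚ_[3]).dim,
      (algebraMap ℤ_[3] ℚ_[3] (r.coeff i)) • (zeta_spec.powerBasis ℚ_[3]).basis i := by
    rw [aeval_eq_sum_range' hdeg, ← Fin.sum_univ_eq_sum_range]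
    refine Finset.sum_congr rfl fun i _ => ?_
    rw [PowerBasis.coe_basis, IsPrimitiveRoot.powerBasis_gen, IsScalarTower.algebraMap_smul]
  rw [hx', hsum, (zeta_spec.powerBasis ℚ_[3]).basis.repr_sum_self]
  exact PadicInt.norm_le_one _

/-- Scaled form: `3ᵈ·x ∈ 𝓞 ⇒ ‖3ᵈ·xᵢ‖ ≤ 1` for every coordinate `xᵢ` of `x` in the power basis. [cite: Washington1997, Prop. 1.2] -/
theorem norm_pow_mul_repr_le_one {x : KNine} {d : ℕ} (hx : IsIntegral ℤ_[3] ((3 : KNine) ^ d * x))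
    (i : Fin (zeta_spec.powerBasis ℚ_[3]).dim) :
    ‖(3 : ℚ_[3]) ^ d * (zeta_spec.powerBasis ℚ_[3]).basis.repr x i‖ ≤ 1 := by
  have h := norm_repr_le_one_of_mem (show (3 : KNine) ^ d * x ∈ ONine from hx) i
  have e : (3 : KNine) ^ d * x = ((3 : ℚ_[3]) ^ d) • x := by
    rw [Algebra.smul_def, map_pow, map_ofNat]
  rwa [e, map_smul, Finsupp.smul_apply, smul_eq_mul] at h

/-- The power-basis elements `ζ₉ⁱ` are integral. [folklore] -/
theorem basis_mem (i : Fin (zeta_spec.powerBasis ℚ_[3]).dim) : (zeta_spec.powerBasis ℚ_[3]).basis i ∈ ONine := by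
  rw [PowerBasis.coe_basis, IsPrimitiveRoot.powerBasis_gen]
  exact pow_mem zeta_mem _

/-- Converse: if every coordinate satisfies `‖3ᵈ·xᵢ‖ ≤ 1` then `3ᵈ·x ∈ 𝓞`. [folklore] -/
theorem isIntegral_pow_mul_of_coords {x : KNine} {d : ℕ}
    (h : ∀ i : Fin (zeta_spec.powerBasis ℚ_[3]).dim, ‖(3 : ℚ_[3]) ^ d * (zeta_spec.powerBasis ℚ_[3]).basis.repr x i‖ ≤ 1) :
    IsIntegral ℤ_[3] ((3 : KNine) ^ d * x) := by
  change (3 : KNine) ^ d * x ∈ ONine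
  have e : (3 : KNine) ^ d * x = ∑ i, ((3 : ℚ_[3]) ^ d * (zeta_spec.powerBasis ℚ_[3]).basis.repr x i) •
      (zeta_spec.powerBasis ℚ_[3]).basis i := by
    conv_lhs => rw [← (zeta_spec.powerBasis ℚ_[3]).basis.sum_repr x]
    rw [Finset.mul_sum]
    refine Finset.sum_congr rfl fun i _ => ?_
    rw [mul_smul, Algebra.smul_def ((3 : ℚ_[3]) ^ d), map_pow, map_ofNat]
  rw [e]
  refine Subalgebra.sum_mem _ fun i _ => ?_
  set z : ℤ_[3] := ⟨(3 : ℚ_[3]) ^ d * (zeta_spec.powerBasis ℚ_[3]).basis.repr x i, h i⟩ with hz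
  have hc : algebraMap ℚ_[3] KNine ((3 : ℚ_[3]) ^ d * (zeta_spec.powerBasis ℚ_[3]).basis.repr x i) ∈ ONine := by
    have e1 : algebraMap ℚ_[3] KNine ((3 : ℚ_[3]) ^ d * (zeta_spec.powerBasis ℚ_[3]).basis.repr x i) =
        algebraMap ℤ_[3] KNine z := by
      rw [IsScalarTower.algebraMap_apply ℤ_[3] ℚ_[3] KNine]; rfl
    rw [e1]
    exact Subalgebra.algebraMap_mem _ _
  rw [Algebra.smul_def]
  exact mul_mem hc (basis_mem i)

/-! ### §2 Coordinate series along the power basis -/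

section Series

variable {σ : Type*}

/-- **Coordinate series exist**: every `F ∈ L⟦σ⟧` has a family `G : Fin 6 → ℚ₃⟦σ⟧` of coordinate series
(`[e]Gᵢ = i`-th coordinate of `[e]F`). [folklore] -/
theorem exists_coords (F : MvPowerSeries σ KNine) :
    ∃ G : Fin (zeta_spec.powerBasis ℚ_[3]).dim → MvPowerSeries σ ℚ_[3],
      ∀ e i, (zeta_spec.powerBasis ℚ_[3]).basis.repr (MvPowerSeries.coeff e F) i = MvPowerSeries.coeff e (G i) :=
  ⟨fun i e => (zeta_spec.powerBasis ℚ_[3]).basis.repr (F e) i, fun _ _ => rfl⟩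

/-- **`F = Σᵢ bᵢ·Gᵢ`** for the coordinate series `Gᵢ` of `F`. [folklore] -/
theorem eq_sum_of_coords {F : MvPowerSeries σ KNine} {G : Fin (zeta_spec.powerBasis ℚ_[3]).dim → MvPowerSeries σ ℚ_[3]}
    (hG : ∀ e i, (zeta_spec.powerBasis ℚ_[3]).basis.repr (MvPowerSeries.coeff e F) i = MvPowerSeries.coeff e (G i)) :
    F = ∑ i, MvPowerSeries.C ((zeta_spec.powerBasis ℚ_[3]).basis i) * (G i).map (algebraMap ℚ_[3] KNine) := by
  ext e
  rw [map_sum, ← (zeta_spec.powerBasis ℚ_[3]).basis.sum_repr (MvPowerSeries.coeff e F)]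
  refine Finset.sum_congr rfl fun i _ => ?_
  rw [MvPowerSeries.coeff_C_mul, MvPowerSeries.coeff_map, hG e i, Algebra.smul_def, mul_comm]

/-- **Uniqueness of coordinates**: if `F = Σᵢ bᵢ·Gᵢ` with `ℚ₃`-series `Gᵢ`, the `Gᵢ` are the coordinate series of `F`.
[folklore] -/
theorem coords_of_eq_sum {F : MvPowerSeries σ KNine} {G : Fin (zeta_spec.powerBasis ℚ_[3]).dim → MvPowerSeries σ ℚ_[3]}
    (hF : F = ∑ i, MvPowerSeries.C ((zeta_spec.powerBasis ℚ_[3]).basis i) * (G i).map (algebraMap ℚ_[3] KNine))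
    (e : σ →₀ ℕ) (i : Fin (zeta_spec.powerBasis ℚ_[3]).dim) :
    (zeta_spec.powerBasis ℚ_[3]).basis.repr (MvPowerSeries.coeff e F) i = MvPowerSeries.coeff e (G i) := by
  have hc : MvPowerSeries.coeff e F = ∑ j, (MvPowerSeries.coeff e (G j)) • (zeta_spec.powerBasis ℚ_[3]).basis j := by
    rw [hF, map_sum]
    refine Finset.sum_congr rfl fun j _ => ?_
    rw [MvPowerSeries.coeff_C_mul, MvPowerSeries.coeff_map, Algebra.smul_def, mul_comm]
  rw [hc, (zeta_spec.powerBasis ℚ_[3]).basis.repr_sum_self]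

/-- **Bounded denominators pass to and from coordinates, uniformly**: `3ᵈ·F ∈ 𝓞⟦σ⟧` iff every coordinate series has
`3ᵈ·Gᵢ ∈ ℤ₃⟦σ⟧` (§1). [cite: Katz1981CrystallineDieudonne, Thm. 5.3.3 (base change)] -/
theorem hbd_coords_iff {F : MvPowerSeries σ KNine} {G : Fin (zeta_spec.powerBasis ℚ_[3]).dim → MvPowerSeries σ ℚ_[3]}
    (hG : ∀ e i, (zeta_spec.powerBasis ℚ_[3]).basis.repr (MvPowerSeries.coeff e F) i = MvPowerSeries.coeff e (G i))
    (d : ℕ) :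
    (∀ e, IsIntegral ℤ_[3] ((3 : KNine) ^ d * MvPowerSeries.coeff e F)) ↔
      ∀ i, IsPadicInt (MvPowerSeries.C ((3 : ℚ_[3]) ^ d) * G i) := by
  constructor
  · intro h i e
    rw [MvPowerSeries.coeff_C_mul, ← hG e i]
    exact norm_pow_mul_repr_le_one (h e) i
  · intro h e
    refine isIntegral_pow_mul_of_coords fun i => ?_
    rw [hG e i, ← MvPowerSeries.coeff_C_mul]
    exact h i e

/-- Coordinates of the constant coefficient. [folklore] -/
theorem coords_constantCoeff {F : MvPowerSeries σ KNine} {G : Fin (zeta_spec.powerBasis ℚ_[3]).dim → MvPowerSeries σ ℚ_[3]}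
    (hG : ∀ e i, (zeta_spec.powerBasis ℚ_[3]).basis.repr (MvPowerSeries.coeff e F) i = MvPowerSeries.coeff e (G i))
    (hF : MvPowerSeries.constantCoeff F = 0) (i : Fin (zeta_spec.powerBasis ℚ_[3]).dim) :
    MvPowerSeries.constantCoeff (G i) = 0 := by
  rw [← MvPowerSeries.coeff_zero_eq_constantCoeff_apply, ← hG 0 i, MvPowerSeries.coeff_zero_eq_constantCoeff_apply, hF,
    map_zero, Finsupp.zero_apply]

/-- **Substitution commutes with coordinates**: if `gᵢ` are the coordinate series of `f ∈ L⟦X⟧` and `A ∈ ℚ₃⟦τ⟧` has no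
constant term, the coordinate series of `f(A)` are the `gᵢ(A)`. [folklore] -/
theorem coords_subst {f : KNine⟦X⟧} {g : Fin (zeta_spec.powerBasis ℚ_[3]).dim → ℚ_[3]⟦X⟧}
    (hg : ∀ e i, (zeta_spec.powerBasis ℚ_[3]).basis.repr (MvPowerSeries.coeff e f) i = MvPowerSeries.coeff e (g i))
    {τ : Type*} {A : MvPowerSeries τ ℚ_[3]} (hA : MvPowerSeries.constantCoeff A = 0) (e : τ →₀ ℕ)
    (i : Fin (zeta_spec.powerBasis ℚ_[3]).dim) :
    (zeta_spec.powerBasis ℚ_[3]).basis.repr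
        (MvPowerSeries.coeff e (f.subst (A.map (algebraMap ℚ_[3] KNine)))) i =
      MvPowerSeries.coeff e ((g i).subst A) := by
  have hAs : HasSubst A := HasSubst.of_constantCoeff_zero hA
  have hA' : MvPowerSeries.constantCoeff (A.map (algebraMap ℚ_[3] KNine)) = 0 := by
    rw [MvPowerSeries.constantCoeff_map, hA, map_zero]
  have hAs' : HasSubst (A.map (algebraMap ℚ_[3] KNine)) := HasSubst.of_constantCoeff_zero hA'
  refine coords_of_eq_sum (G := fun j => (g j).subst A) ?_ e i
  have hf := eq_sum_of_coords hg
  rw [hf, ← coe_substAlgHom hAs', map_sum]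
  have hC : ∀ r : KNine, PowerSeries.subst (A.map (algebraMap ℚ_[3] KNine)) (MvPowerSeries.C r : KNine⟦X⟧) =
      MvPowerSeries.C r := fun r => PowerSeries.subst_C r
  refine Finset.sum_congr rfl fun j _ => ?_
  rw [map_mul, coe_substAlgHom hAs', hC]
  congr 1
  exact (PowerSeries.map_subst hAs (g j)).symm

/-- **Power maps commute with coordinates**: the coordinate series of `f(z^q)` are the `gᵢ(z^q)`. [folklore] -/
theorem coords_expand {f : KNine⟦X⟧} {g : Fin (zeta_spec.powerBasis ℚ_[3]).dim → ℚ_[3]⟦X⟧}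
    (hg : ∀ e i, (zeta_spec.powerBasis ℚ_[3]).basis.repr (MvPowerSeries.coeff e f) i = MvPowerSeries.coeff e (g i))
    (q : ℕ) (hq : q ≠ 0) (e : Unit →₀ ℕ) (i : Fin (zeta_spec.powerBasis ℚ_[3]).dim) :
    (zeta_spec.powerBasis ℚ_[3]).basis.repr (MvPowerSeries.coeff e (expand q hq f)) i =
      MvPowerSeries.coeff e (expand q hq (g i)) := by
  refine coords_of_eq_sum (G := fun j => expand q hq (g j)) ?_ e i
  rw [eq_sum_of_coords hg, map_sum]
  have hC : ∀ r : KNine, expand q hq (MvPowerSeries.C r : KNine⟦X⟧) = MvPowerSeries.C r :=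
    fun r => PowerSeries.expand_C q hq r
  refine Finset.sum_congr rfl fun j _ => ?_
  rw [map_mul, hC]
  congr 1
  exact (PowerSeries.map_expand q hq (algebraMap ℚ_[3] KNine) (g j)).symm

/-- `n·[zⁿ]` bounds pass to coordinates: `3ᵈ·n·[zⁿ]f ∈ 𝓞 ⇒ ‖3ᵈ·n·[zⁿ]gᵢ‖ ≤ 1`. [folklore] -/
theorem coords_logType {f : KNine⟦X⟧} {g : Fin (zeta_spec.powerBasis ℚ_[3]).dim → ℚ_[3]⟦X⟧}
    (hg : ∀ e i, (zeta_spec.powerBasis ℚ_[3]).basis.repr (MvPowerSeries.coeff e f) i = MvPowerSeries.coeff e (g i))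
    {d : ℕ} (h : ∀ n : ℕ, IsIntegral ℤ_[3] ((3 : KNine) ^ d * ((n : KNine) * coeff n f))) (n : ℕ)
    (i : Fin (zeta_spec.powerBasis ℚ_[3]).dim) :
    ‖(3 : ℚ_[3]) ^ d * ((n : ℚ_[3]) * coeff n (g i))‖ ≤ 1 := by
  have hn : (n : KNine) * coeff n f = (n : ℚ_[3]) • coeff n f := by
    rw [Algebra.smul_def, map_natCast]
  have key := norm_pow_mul_repr_le_one (h n) i
  rw [hn, map_smul, Finsupp.smul_apply, smul_eq_mul, show coeff n f = MvPowerSeries.coeff (Finsupp.single () n) f from rfl,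
    hg, show MvPowerSeries.coeff (Finsupp.single () n) (g i) = coeff n (g i) from rfl] at key
  exact key

end Series

end Summit.BirchSwinnertonDyer.BirchSwinnertonDyer.Theorems.NineCoordinates

end
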